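import Mathlib.Combinatorics.SimpleGraph.Connectivity.Connected
import Mathlib.Logic.Relation
import HarnessLib

/-!
# `NoHeavyLowerTail` (stmt-CriticalPhenomena-4575) — decoupling across a vertex separator, part 1:
# reachability in a graph glued from two pieces along a set of terminals

Support file (prover prim-sahi-p2, SAHI cell P2 "restricted C₃ via percolation structure"; `--supports stmt-CriticalPhenomena-4575`).
Pure graph combinatorics: no measure theory, no definitions, no named facts, no sorries.

SETTING.  Two graphs `G₁, G₂` on one vertex type that SHARE ONLY TERMINALS: every vertex having a neighbour in `G₁` and a neighbour
in `G₂` lies in `T` (for two edge-disjoint pieces of a graph glued along `T`: the pieces meet only in `T`).  A ONE-PIECE connection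
is `G₁.Reachable x y ∨ G₂.Reachable x y`; a TERMINAL CHAIN is an element of the reflexive–transitive closure
`Relation.ReflTransGen (fun u w => u ∈ T ∧ w ∈ T ∧ (G₁.Reachable u w ∨ G₂.Reachable u w))` (one-piece connections between terminals).

WHAT.  `reachable_sup_decomp`: a connection `x ↔ y` in `G₁ ⊔ G₂` is either a one-piece connection, or a one-piece connection from `x`
to a terminal, a terminal chain, and a one-piece connection from a terminal to `y` (induction on a walk: consecutive edges from different
pieces meet at a terminal).  Consequences used by part 2 (the five three-point cells of a glued percolation system,
`…CubicThreePointGluingCells`):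
* `reachable_sup_iff_chain` — between terminals, `↔` in `G₁ ⊔ G₂` IS the terminal chain relation;
* THREE TERMINALS `a, b, c` (the parallel / JOIN composition of two three-terminal networks): `threeTerm_iso` — if `c` is joined to
  neither `a` nor `b` inside either piece, then in `G₁ ⊔ G₂` it is joined to neither, and `a ↔ b` in `G₁ ⊔ G₂` iff `a ↔ b` inside one
  piece (so the partition of `{a,b,c}` induced by `G₁ ⊔ G₂` is the lattice JOIN of the partitions induced by the pieces: the only relays
  are the terminals themselves);
* ONE TERMINAL `h` (a cut vertex / pendant composition): `cutVertex_iff` — `x ↔ y` in `G₁ ⊔ G₂` iff inside one piece, or `x ↔ h` and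
  `h ↔ y` inside pieces; `pendant_ab`, `pendant_bc` — with `a` only in piece 1 and `b, c` only in piece 2, `a ↔ b` iff
  `a ↔₁ h ∧ h ↔₂ b`, and `b ↔ c` iff `b ↔₂ c`.
This is the deterministic half of "decoupling across a separating set"; with independent edges on the two pieces it turns the
three-point connectivity law of the glued graph into the join (resp. meet-with-an-arm) composition of the pieces' laws, to which the
K3-semigroup theorem of `…CubicThreePointJoinClosure` applies (part 3, `…CubicThreePointGluingMoves`).
[cite: Grimmett1999, §2.2 (independence of disjoint edge sets)]
-/

namespace Summit.CriticalPhenomena.PercolationContinuityZ3.Theorems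

namespace TerminalGluing

open SimpleGraph

variable {V : Type*}

/-! ### One-piece connections and terminal chains -/

/-- A one-piece connection is a connection in the glued graph. [folklore] -/
theorem reachable_sup_of_side {G₁ G₂ : SimpleGraph V} {x y : V} (h : G₁.Reachable x y ∨ G₂.Reachable x y) :
    (G₁ ⊔ G₂).Reachable x y :=
  h.elim (fun h => h.mono le_sup_left) fun h => h.mono le_sup_right

/-- A terminal chain is a connection in the glued graph. [folklore] -/
theorem reachable_sup_of_chain {G₁ G₂ : SimpleGraph V} {T : Set V} {x y : V}
    (h : Relation.ReflTransGen (fun u w => u ∈ T ∧ w ∈ T ∧ (G₁.Reachable u w ∨ G₂.Reachable u w)) x y) :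
    (G₁ ⊔ G₂).Reachable x y := by
  induction h with
  | refl => exact Reachable.refl _
  | tail _ hstep ih => exact ih.trans (reachable_sup_of_side hstep.2.2)

/-- A vertex joined to a DIFFERENT vertex has a neighbour (the first edge of a path). [folklore] -/
theorem exists_adj_of_reachable_ne {G : SimpleGraph V} {b y : V} (h : G.Reachable b y) (hne : b ≠ y) :
    ∃ u, G.Adj b u := by
  obtain ⟨p⟩ := h
  cases p with
  | nil => exact absurd rfl hne
  | cons hadj _ => exact ⟨_, hadj⟩

/-- A vertex with no neighbour in `G` is joined in `G` only to itself. [folklore] -/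
theorem eq_of_reachable_of_isolated {G : SimpleGraph V} {b y : V} (hb : ∀ u, ¬ G.Adj b u) (h : G.Reachable b y) :
    b = y := by
  by_contra hne
  obtain ⟨u, hu⟩ := exists_adj_of_reachable_ne h hne
  exact hb u hu

/-! ### The decomposition of a connection in the glued graph -/

section Decomp

variable {G₁ G₂ : SimpleGraph V} {T : Set V}

/-- One induction step of `reachable_sup_decomp`: prepend an edge of the FIRST piece. [folklore] -/
theorem decomp_cons₁ (hT : ∀ v u u', G₁.Adj v u → G₂.Adj v u' → v ∈ T) {v b y : V} (hvb : G₁.Adj v b)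
    (ih : (G₁.Reachable b y ∨ G₂.Reachable b y) ∨
      ∃ z z', z ∈ T ∧ z' ∈ T ∧ (G₁.Reachable b z ∨ G₂.Reachable b z) ∧
        Relation.ReflTransGen (fun u w => u ∈ T ∧ w ∈ T ∧ (G₁.Reachable u w ∨ G₂.Reachable u w)) z z' ∧
        (G₁.Reachable z' y ∨ G₂.Reachable z' y)) :
    (G₁.Reachable v y ∨ G₂.Reachable v y) ∨
      ∃ z z', z ∈ T ∧ z' ∈ T ∧ (G₁.Reachable v z ∨ G₂.Reachable v z) ∧
        Relation.ReflTransGen (fun u w => u ∈ T ∧ w ∈ T ∧ (G₁.Reachable u w ∨ G₂.Reachable u w)) z z' ∧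
        (G₁.Reachable z' y ∨ G₂.Reachable z' y) := by
  rcases ih with hby | ⟨z, z', hz, hz', hbz, hzz', hz'y⟩
  · rcases hby with h1 | h2
    · exact Or.inl (Or.inl (hvb.reachable.trans h1))
    · by_cases hby : b = y
      · subst hby
        exact Or.inl (Or.inl hvb.reachable)
      · obtain ⟨u', hu'⟩ := exists_adj_of_reachable_ne h2 hby
        have hb : b ∈ T := hT b v u' hvb.symm hu'
        exact Or.inr ⟨b, b, hb, hb, Or.inl hvb.reachable, Relation.ReflTransGen.refl, Or.inr h2⟩
  · rcases hbz with h1 | h2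
    · exact Or.inr ⟨z, z', hz, hz', Or.inl (hvb.reachable.trans h1), hzz', hz'y⟩
    · by_cases hbz : b = z
      · subst hbz
        exact Or.inr ⟨b, z', hz, hz', Or.inl hvb.reachable, hzz', hz'y⟩
      · obtain ⟨u', hu'⟩ := exists_adj_of_reachable_ne h2 hbz
        have hb : b ∈ T := hT b v u' hvb.symm hu'
        exact Or.inr ⟨b, z', hb, hz', Or.inl hvb.reachable,
          Relation.ReflTransGen.head ⟨hb, hz, Or.inr h2⟩ hzz', hz'y⟩

/-- One induction step of `reachable_sup_decomp`: prepend an edge of the SECOND piece. [folklore] -/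
theorem decomp_cons₂ (hT : ∀ v u u', G₁.Adj v u → G₂.Adj v u' → v ∈ T) {v b y : V} (hvb : G₂.Adj v b)
    (ih : (G₁.Reachable b y ∨ G₂.Reachable b y) ∨
      ∃ z z', z ∈ T ∧ z' ∈ T ∧ (G₁.Reachable b z ∨ G₂.Reachable b z) ∧
        Relation.ReflTransGen (fun u w => u ∈ T ∧ w ∈ T ∧ (G₁.Reachable u w ∨ G₂.Reachable u w)) z z' ∧
        (G₁.Reachable z' y ∨ G₂.Reachable z' y)) :
    (G₁.Reachable v y ∨ G₂.Reachable v y) ∨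
      ∃ z z', z ∈ T ∧ z' ∈ T ∧ (G₁.Reachable v z ∨ G₂.Reachable v z) ∧
        Relation.ReflTransGen (fun u w => u ∈ T ∧ w ∈ T ∧ (G₁.Reachable u w ∨ G₂.Reachable u w)) z z' ∧
        (G₁.Reachable z' y ∨ G₂.Reachable z' y) := by
  rcases ih with hby | ⟨z, z', hz, hz', hbz, hzz', hz'y⟩
  · rcases hby with h1 | h2
    · by_cases hby : b = y
      · subst hby
        exact Or.inl (Or.inr hvb.reachable)
      · obtain ⟨u', hu'⟩ := exists_adj_of_reachable_ne h1 hby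
        have hb : b ∈ T := hT b u' v hu' hvb.symm
        exact Or.inr ⟨b, b, hb, hb, Or.inr hvb.reachable, Relation.ReflTransGen.refl, Or.inl h1⟩
    · exact Or.inl (Or.inr (hvb.reachable.trans h2))
  · rcases hbz with h1 | h2
    · by_cases hbz : b = z
      · subst hbz
        exact Or.inr ⟨b, z', hz, hz', Or.inr hvb.reachable, hzz', hz'y⟩
      · obtain ⟨u', hu'⟩ := exists_adj_of_reachable_ne h1 hbz
        have hb : b ∈ T := hT b u' v hu' hvb.symm
        exact Or.inr ⟨b, z', hb, hz', Or.inr hvb.reachable,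
          Relation.ReflTransGen.head ⟨hb, hz, Or.inl h1⟩ hzz', hz'y⟩
    · exact Or.inr ⟨z, z', hz, hz', Or.inr (hvb.reachable.trans h2), hzz', hz'y⟩

/-- **Decomposition of a connection in a glued graph.**  If every vertex with neighbours in both pieces is a terminal, then
`x ↔ y` in `G₁ ⊔ G₂` implies: `x ↔ y` inside one piece, or there are terminals `z, z'` with `x ↔ z` inside one piece, a terminal
chain from `z` to `z'`, and `z' ↔ y` inside one piece. [folklore] -/
theorem reachable_sup_decomp (hT : ∀ v u u', G₁.Adj v u → G₂.Adj v u' → v ∈ T) {x y : V}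
    (h : (G₁ ⊔ G₂).Reachable x y) :
    (G₁.Reachable x y ∨ G₂.Reachable x y) ∨
      ∃ z z', z ∈ T ∧ z' ∈ T ∧ (G₁.Reachable x z ∨ G₂.Reachable x z) ∧
        Relation.ReflTransGen (fun u w => u ∈ T ∧ w ∈ T ∧ (G₁.Reachable u w ∨ G₂.Reachable u w)) z z' ∧
        (G₁.Reachable z' y ∨ G₂.Reachable z' y) := by
  obtain ⟨p⟩ := h
  induction p with
  | nil => exact Or.inl (Or.inl (Reachable.refl _))
  | cons hadj _ ih =>
    rcases (sup_adj ..).1 hadj with h1 | h2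
    · exact decomp_cons₁ hT h1 ih
    · exact decomp_cons₂ hT h2 ih

/-- **Between terminals, connection in the glued graph is the terminal chain relation.** [folklore] -/
theorem reachable_sup_iff_chain (hT : ∀ v u u', G₁.Adj v u → G₂.Adj v u' → v ∈ T) {x y : V}
    (hx : x ∈ T) (hy : y ∈ T) :
    (G₁ ⊔ G₂).Reachable x y ↔
      Relation.ReflTransGen (fun u w => u ∈ T ∧ w ∈ T ∧ (G₁.Reachable u w ∨ G₂.Reachable u w)) x y := by
  refine ⟨fun h => ?_, reachable_sup_of_chain⟩
  rcases reachable_sup_decomp hT h with hs | ⟨z, z', hz, hz', hxz, hzz', hz'y⟩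
  · exact Relation.ReflTransGen.single ⟨hx, hy, hs⟩
  · exact (Relation.ReflTransGen.head ⟨hx, hz, hxz⟩ hzz').tail ⟨hz', hy, hz'y⟩

end Decomp

/-! ### Three terminals: the join composition -/

section ThreeTerminals

variable {G₁ G₂ : SimpleGraph V} {a b c : V}

/-- Invariant of a terminal chain from `a` (terminal set `{a, b, c}`) when `c` is isolated from `a` and `b` inside both pieces: the
chain stays at `a`, or sits at `b` having witnessed a one-piece connection `a ↔ b`. [folklore] -/
theorem chain_from_a_of_iso (hac : ¬ (G₁.Reachable a c ∨ G₂.Reachable a c)) (hbc : ¬ (G₁.Reachable b c ∨ G₂.Reachable b c))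
    {y : V} (h : Relation.ReflTransGen
      (fun u w => u ∈ {v | v = a ∨ v = b ∨ v = c} ∧ w ∈ {v | v = a ∨ v = b ∨ v = c} ∧ (G₁.Reachable u w ∨ G₂.Reachable u w)) a y) :
    y = a ∨ (y = b ∧ (G₁.Reachable a b ∨ G₂.Reachable a b)) := by
  induction h with
  | refl => exact Or.inl rfl
  | @tail w y' _ hstep ih =>
    obtain ⟨_, hy', hside⟩ := hstep
    rcases hy' with rfl | rfl | rfl
    · exact Or.inl rfl
    · rcases ih with rfl | ⟨rfl, hab⟩
      · exact Or.inr ⟨rfl, hside⟩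
      · exact Or.inr ⟨rfl, hab⟩
    · rcases ih with rfl | ⟨rfl, _⟩
      · exact absurd hside hac
      · exact absurd hside hbc

/-- **Join cells, `c` isolated.**  If the pieces share only the terminals `a, b, c` and `c` is joined to neither `a` nor `b` inside
either piece, then in the glued graph `c` is joined to neither, and `a ↔ b` iff `a ↔ b` inside one piece. [folklore] -/
theorem threeTerm_iso (hT : ∀ v u u', G₁.Adj v u → G₂.Adj v u' → (v = a ∨ v = b ∨ v = c))
    (hac : ¬ (G₁.Reachable a c ∨ G₂.Reachable a c)) (hbc : ¬ (G₁.Reachable b c ∨ G₂.Reachable b c)) :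
    ((G₁ ⊔ G₂).Reachable a b ↔ (G₁.Reachable a b ∨ G₂.Reachable a b)) ∧ ¬ (G₁ ⊔ G₂).Reachable a c ∧
      ¬ (G₁ ⊔ G₂).Reachable b c := by
  have hT₀ : ∀ v u u', G₁.Adj v u → G₂.Adj v u' → v ∈ {v | v = a ∨ v = b ∨ v = c} := hT
  have ha : a ∈ {v | v = a ∨ v = b ∨ v = c} := Or.inl rfl
  have hb : b ∈ {v | v = a ∨ v = b ∨ v = c} := Or.inr (Or.inl rfl)
  have hc : c ∈ {v | v = a ∨ v = b ∨ v = c} := Or.inr (Or.inr rfl)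
  refine ⟨⟨fun h => ?_, reachable_sup_of_side⟩, fun h => ?_, fun h => ?_⟩
  · rcases chain_from_a_of_iso hac hbc ((reachable_sup_iff_chain hT₀ ha hb).1 h) with hba | ⟨_, hab⟩
    · rw [hba]; exact Or.inl (Reachable.refl _)
    · exact hab
  · rcases chain_from_a_of_iso hac hbc ((reachable_sup_iff_chain hT₀ ha hc).1 h) with hca | ⟨hcb, _⟩
    · exact hac (hca ▸ Or.inl (Reachable.refl _))
    · exact hbc (hcb ▸ Or.inl (Reachable.refl _))
  · -- run the same invariant from `b`: exchange the roles of `a` and `b`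
    have hT' : ∀ v u u', G₁.Adj v u → G₂.Adj v u' → v ∈ {v | v = b ∨ v = a ∨ v = c} := fun v u u' h1 h2 => by
      rcases hT v u u' h1 h2 with h | h | h
      · exact Or.inr (Or.inl h)
      · exact Or.inl h
      · exact Or.inr (Or.inr h)
    have hb' : b ∈ {v | v = b ∨ v = a ∨ v = c} := Or.inl rfl
    have hc' : c ∈ {v | v = b ∨ v = a ∨ v = c} := Or.inr (Or.inr rfl)
    rcases chain_from_a_of_iso hbc hac ((reachable_sup_iff_chain hT' hb' hc').1 h) with hcb | ⟨hca, _⟩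
    · exact hbc (hcb ▸ Or.inl (Reachable.refl _))
    · exact hac (hca ▸ Or.inl (Reachable.refl _))

end ThreeTerminals

/-! ### One terminal: cut vertex / pendant composition -/

section CutVertex

variable {G₁ G₂ : SimpleGraph V} {h : V}

/-- **Cut vertex.**  If the pieces share only the vertex `h`, then `x ↔ y` in the glued graph iff `x ↔ y` inside one piece, or
`x ↔ h` and `h ↔ y` inside (possibly different) pieces. [folklore] -/
theorem cutVertex_iff (hT : ∀ v u u', G₁.Adj v u → G₂.Adj v u' → v = h) {x y : V} :
    (G₁ ⊔ G₂).Reachable x y ↔ (G₁.Reachable x y ∨ G₂.Reachable x y) ∨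
      ((G₁.Reachable x h ∨ G₂.Reachable x h) ∧ (G₁.Reachable h y ∨ G₂.Reachable h y)) := by
  refine ⟨fun hr => ?_, fun hr => ?_⟩
  · rcases reachable_sup_decomp (T := {v | v = h}) hT hr with hs | ⟨z, z', hz, hz', hxz, _, hz'y⟩
    · exact Or.inl hs
    · have hz1 : z = h := hz
      have hz2 : z' = h := hz'
      subst hz1 hz2
      exact Or.inr ⟨hxz, hz'y⟩
  · rcases hr with hs | ⟨h1, h2⟩
    · exact reachable_sup_of_side hs
    · exact (reachable_sup_of_side h1).trans (reachable_sup_of_side h2)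

variable {a b c : V}

/-- **Pendant composition, the connection `a ↔ b`.**  Pieces sharing only `h`; `a` has no edge of piece 2, `b` no edge of piece 1,
`a ≠ b`: then `a ↔ b` in the glued graph iff `a ↔ h` in piece 1 and `h ↔ b` in piece 2. [folklore] -/
theorem pendant_ab (hT : ∀ v u u', G₁.Adj v u → G₂.Adj v u' → v = h) (ha : ∀ u, ¬ G₂.Adj a u)
    (hb : ∀ u, ¬ G₁.Adj b u) (hab : a ≠ b) :
    (G₁ ⊔ G₂).Reachable a b ↔ G₁.Reachable a h ∧ G₂.Reachable h b := by
  rw [cutVertex_iff hT]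
  constructor
  · rintro (hs | ⟨h1, h2⟩)
    · rcases hs with h1 | h2
      · exact absurd (eq_of_reachable_of_isolated hb h1.symm).symm hab
      · exact absurd (eq_of_reachable_of_isolated ha h2) hab
    · refine ⟨?_, ?_⟩
      · rcases h1 with h1 | h1
        · exact h1
        · rw [← eq_of_reachable_of_isolated ha h1]
      · rcases h2 with h2 | h2
        · rw [eq_of_reachable_of_isolated hb h2.symm]
        · exact h2
  · rintro ⟨h1, h2⟩
    exact Or.inr ⟨Or.inl h1, Or.inr h2⟩

/-- **Pendant composition, the connection `b ↔ c`.**  Pieces sharing only `h`; `b` and `c` have no edge of piece 1: then `b ↔ c`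
in the glued graph iff `b ↔ c` in piece 2. [folklore] -/
theorem pendant_bc (hT : ∀ v u u', G₁.Adj v u → G₂.Adj v u' → v = h) (hb : ∀ u, ¬ G₁.Adj b u)
    (hc : ∀ u, ¬ G₁.Adj c u) : (G₁ ⊔ G₂).Reachable b c ↔ G₂.Reachable b c := by
  rw [cutVertex_iff hT]
  have side_b : ∀ {y}, (G₁.Reachable b y ∨ G₂.Reachable b y) → G₂.Reachable b y := fun hs => by
    rcases hs with h1 | h2
    · rw [eq_of_reachable_of_isolated hb h1]
    · exact h2
  have side_c : ∀ {y}, (G₁.Reachable y c ∨ G₂.Reachable y c) → G₂.Reachable y c := fun hs => by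
    rcases hs with h1 | h2
    · rw [eq_of_reachable_of_isolated hc h1.symm]
    · exact h2
  constructor
  · rintro (hs | ⟨h1, h2⟩)
    · exact side_b hs
    · exact (side_b h1).trans (side_c h2)
  · exact fun h2 => Or.inl (Or.inr h2)

end CutVertex

end TerminalGluing

end Summit.CriticalPhenomena.PercolationContinuityZ3.Theorems
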